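import Literature.MathematicalPhysics.QuantumLattice.PeierlsHoppingThermalTwistBound
import Literature.MathematicalPhysics.QuantumLattice.HubbardNNNHoppingFluxGaugeFunction
import HarnessLib

/-!
# The thermal twist bound in a background orbital field for the `t–t′` band: every thermal flux stiffness of the
# `t–t′` Hubbard torus in ANY lattice `U(1)` gauge field is at most `1 + 2|t′|`, at every temperature

Topic `Literature/MathematicalPhysics/QuantumLattice` (family `hubbard`). Everything here is PROVED (three operator
definitions, no named fact). The `t–t′` extension of `PeierlsHoppingThermalTwistBound.lean` (nearest-neighbour band, background
field on the `e₁, e₂` bonds: `magneticThermalFluxStiffness_le_one`). For the `t–t′` band BOTH diagonal bond families `x → x + j_s`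
(`j_0 = e₁ + e₂`, `j_1 = e₁ − e₂`) advance `x₁` by one, so an `e₁`-handle twist is paid by the nearest-neighbour `e₁`-bonds AND by the
diagonal bonds (weight `|t′|` each) — exactly as at zero field, where the operator paying for the twist is `kinOpTT' = K_x + t′ K_d`
(`HubbardNNNHoppingFluxThermal.lean`). In an arbitrary field there is no translation invariance to bound the three families jointly, so
the crude field-robust constant is `1 + 2|t′|` (each `e₁`-bond amplitude `≤ ½`, each diagonal amplitude `≤ ½`, `L²` + `2L²` bonds per
spin). Requested by the Hubbard cuprate cell `pub/hubbard-tc` (MO-S3, KT back-end; H-axis «orbital» locator for the `t–t′` boxes of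
the material table, lead RULING R50 follow-up, 2026-08-27).

Objects (`L ≥ 1`; `A : GaugeConfig 2 L Circle` the phases of the nearest-neighbour bonds, `D : Fin 2 → Site 2 L → Circle` the phases of
the diagonal bonds — together an ARBITRARY lattice `U(1)` gauge field on the `t–t′` bond graph; `t = 1`):
* `magneticHubbardTorusTT' L A D t′ U = magneticHubbardTorus L A 1 U + (−t′)·diagPeierlsHopping L D` — the `t–t′` Hubbard torus in the
  field (at `A = 1`, `D = 1`, `L ≥ 3` this is `hubbardTorusTT' L 1 t′ U`, cf. `hubbardTorusTT'_eq_magneticHubbardTorus_add_diag`);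
* `diagTwist L D θ` — the diagonal phases with the extra handle flux: `D_s(x)·e^{iθ/L}` (every diagonal bond advances `x₁` by one;
  Watanabe 2019 §2.2.3), the nearest-neighbour ones being `A · uniformTwistConfig L θ` as before;
* `magneticKinOpTT' L A D t′ = magneticKinOp L A + t′·diagPeierlsHopping L D` — the field-dressed `x₁`-kinetic operator.
Results:
* `re_star_dotProduct_magneticTwistTT'_add_neg_mulVec` — midpoint identity in a vector:
  `Re⟨φ,(H_θ + H_{−θ})φ⟩ = 2Re⟨φ,Hφ⟩ + 2(1 − cos(θ/L)) Re⟨φ, K^{A,D}_{t′} φ⟩`;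
* `log_partitionFn_toBlock_magneticTwistTT'_add_neg_ge` — **thermal f-sum bound in the field, `t–t′` band**: on every coordinate sector
  `p` and for every `β`, `2 log Z_p(0) − 2β(1 − cos(θ/L)) Re⟨K^{A,D}_{t′}|_p⟩_{β,p} ≤ log Z_p(θ) + log Z_p(−θ)` (Peierls–Bogoliubov at `±θ`);
* `abs_re_gibbsState_magneticKinOpTT'_le` — `|Re⟨K^{A,D}_{t′}|_p⟩| ≤ 2L²(1 + 2|t′|)` (`L ≥ 2`);
* `magneticThermalFluxStiffnessTT'_le` — **every thermal flux-stiffness constant is `≤ 1 + 2|t′|`** (units of `t`; `L ≥ 2`, `β > 0`):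
  `β ρ θ² ≤ log Z_p(0) − log Z_p(θ)` on `|θ| ≤ θ₀` forces `ρ ≤ 1 + 2|t′|`, for every gauge field `(A, D)`, every `U`, every coordinate sector
  (hence every filling and every uniform Zeeman field) and every temperature.
With the Nelson–Kosterlitz reading of the cell (a HYPOTHESIS there, not a theorem here) this is `k_BT_KT ≤ (π/4)(1 + 2|t′|)·t` per
plane at every orbital field — coverage, not tightness (the zero-field kinematic rows are far sharper).

HONEST SCOPE: elementary Peierls–Bogoliubov inequalities on finite-dimensional matrices; no number of physical interest; nothing about
superconductivity or the existence of a transition; no thermodynamic limit taken.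

## References
* A. Paramekanti, N. Trivedi, M. Randeria, PRB 57 (1998) 11639, §II, §IV eqs. (heat), (trial-rho). [ParamekantiTrivediRanderia1998]
* T. Hazra, N. Verma, M. Randeria, PRX 9 (2019) 031049, eqs. (2), (4) (`D̃` of the `t–t′` band). [HazraVermaRanderia2019]
* H. Watanabe, J. Stat. Phys. 177 (2019) 717, §2.2.3, §4.1 (every `x₁`-advancing term acquires the phase). [Watanabe2019]
* E. H. Lieb, PRL 73 (1994) 2158, eq. (1) (Peierls phases). [Lieb1994]
* D. J. Scalapino, S. R. White, S. Zhang, PRB 47 (1993) 7995, §II. [ScalapinoWhiteZhang1993]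
-/

noncomputable section

namespace Literature.MathematicalPhysics.QuantumLattice

open Matrix Finset Literature.MathematicalPhysics.QuantumFieldTheory
open scoped ComplexConjugate ComplexOrder

/-! ## §0 A generic Loewner sandwich from a unit-vector bound -/

section Sandwich

variable {ι : Type*} [Fintype ι] [DecidableEq ι]

/-- **Unit-vector bound ⇒ Loewner sandwich**: if `K` is Hermitian and `|Re⟨φ, Kφ⟩| ≤ c` for every unit vector `φ`, then
`c·1 + s·K ⪰ 0` for every real `|s| ≤ 1` (normalise a nonzero vector). [folklore] -/
private theorem posSemidef_smul_one_add_smul_of_unit_bound {K : Matrix ι ι ℂ} (hK : K.IsHermitian) {c : ℝ}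
    (hunit : ∀ φ : ι → ℂ, star φ ⬝ᵥ φ = 1 → |(star φ ⬝ᵥ (K *ᵥ φ)).re| ≤ c) {s : ℝ} (hs : |s| ≤ 1) :
    (((c : ℝ) : ℂ) • (1 : Matrix ι ι ℂ) + ((s : ℝ) : ℂ) • K).PosSemidef := by
  have hH : ((((c : ℝ) : ℂ) • (1 : Matrix ι ι ℂ) + ((s : ℝ) : ℂ) • K)).IsHermitian :=
    (isHermitian_ofReal_smul isHermitian_one _).add (isHermitian_ofReal_smul hK _)
  refine PosSemidef.of_dotProduct_mulVec_nonneg hH fun x => ?_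
  have him := hH.im_star_dotProduct_mulVec_self x
  rw [Complex.nonneg_iff]
  refine ⟨?_, by simpa using him.symm⟩
  have hexp : (star x ⬝ᵥ (((((c : ℝ) : ℂ) • (1 : Matrix ι ι ℂ) + ((s : ℝ) : ℂ) • K)) *ᵥ x)).re =
      c * (star x ⬝ᵥ x).re + s * (star x ⬝ᵥ (K *ᵥ x)).re := by
    rw [add_mulVec, smul_mulVec, smul_mulVec, one_mulVec, dotProduct_add, dotProduct_smul, dotProduct_smul,
      smul_eq_mul, smul_eq_mul, Complex.add_re, Complex.re_ofReal_mul, Complex.re_ofReal_mul]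
  rw [hexp]
  by_cases hx : x = 0
  · subst hx; simp
  obtain ⟨a, ha0, ha1⟩ := exists_smul_unit hx
  have haa : star a * a = ((‖a‖ ^ 2 : ℝ) : ℂ) := by
    rw [Complex.star_def, Complex.conj_mul', Complex.ofReal_pow]
  have hK' : star (a • x) ⬝ᵥ (K *ᵥ (a • x)) = ((‖a‖ ^ 2 : ℝ) : ℂ) * (star x ⬝ᵥ (K *ᵥ x)) := by
    rw [star_smul, mulVec_smul, smul_dotProduct, dotProduct_smul, smul_smul, haa, smul_eq_mul]
  have hnorm : ((‖a‖ ^ 2 : ℝ) : ℂ) * (star x ⬝ᵥ x) = 1 := by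
    rw [← ha1, star_smul, smul_dotProduct, dotProduct_smul, smul_smul, haa, smul_eq_mul]
  have hnorm' : ‖a‖ ^ 2 * (star x ⬝ᵥ x).re = 1 := by
    have := congrArg Complex.re hnorm
    rwa [Complex.re_ofReal_mul, Complex.one_re] at this
  have hu := hunit (a • x) ha1
  rw [hK', Complex.re_ofReal_mul] at hu
  have ha2 : 0 < ‖a‖ ^ 2 := by positivity
  have hbound : |(star x ⬝ᵥ (K *ᵥ x)).re| ≤ c * (star x ⬝ᵥ x).re := by
    have h1 : ‖a‖ ^ 2 * |(star x ⬝ᵥ (K *ᵥ x)).re| ≤ c := by rwa [abs_mul, abs_of_pos ha2] at hu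
    have h2 : ‖a‖ ^ 2 * |(star x ⬝ᵥ (K *ᵥ x)).re| ≤ ‖a‖ ^ 2 * (c * (star x ⬝ᵥ x).re) := by
      calc ‖a‖ ^ 2 * |(star x ⬝ᵥ (K *ᵥ x)).re| ≤ c := h1
        _ = c * (‖a‖ ^ 2 * (star x ⬝ᵥ x).re) := by rw [hnorm', mul_one]
        _ = ‖a‖ ^ 2 * (c * (star x ⬝ᵥ x).re) := by ring
    exact le_of_mul_le_mul_left h2 ha2
  have hs' : |s * (star x ⬝ᵥ (K *ᵥ x)).re| ≤ c * (star x ⬝ᵥ x).re := by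
    rw [abs_mul]
    calc |s| * |(star x ⬝ᵥ (K *ᵥ x)).re| ≤ 1 * |(star x ⬝ᵥ (K *ᵥ x)).re| := by gcongr
      _ ≤ c * (star x ⬝ᵥ x).re := by rw [one_mul]; exact hbound
  have := neg_abs_le (s * (star x ⬝ᵥ (K *ᵥ x)).re)
  linarith

/-- **Loewner sandwich ⇒ Gibbs bound**: under the hypotheses of the previous lemma, `|Re⟨K|_p⟩_{β,B}| ≤ c` for every coordinate
sector `p` and the Gibbs state of ANY Hermitian block Hamiltonian `B`. [folklore] -/
private theorem abs_re_gibbsState_toBlock_le_of_unit_bound {K : Matrix ι ι ℂ} (hK : K.IsHermitian) {c : ℝ} (hc : 0 ≤ c)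
    (hunit : ∀ φ : ι → ℂ, star φ ⬝ᵥ φ = 1 → |(star φ ⬝ᵥ (K *ᵥ φ)).re| ≤ c) (β : ℝ) (p : ι → Prop)
    [Fintype {a // p a}] [DecidableEq {a // p a}] {B : Matrix {a // p a} {a // p a} ℂ} (hB : B.IsHermitian) :
    |(gibbsState β B (K.toBlock p p)).re| ≤ c := by
  rcases isEmpty_or_nonempty {a // p a} with hp | hp
  · have h0 : gibbsState β B (K.toBlock p p) = 0 := by simp [gibbsState_apply, Matrix.trace]
    rw [h0, Complex.zero_re, abs_zero]
    exact hc
  have hone : gibbsState β B 1 = 1 := gibbsState_one β B (partitionFn_pos β hB).ne'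
  have key : ∀ s : ℝ, |s| ≤ 1 → 0 ≤ c + s * (gibbsState β B (K.toBlock p p)).re := by
    intro s hs
    have hpsd := posSemidef_smul_one_add_smul_of_unit_bound hK hunit hs
    have h1 : 0 ≤ gibbsState β B ((((c : ℝ) : ℂ) • (1 : Matrix ι ι ℂ) + ((s : ℝ) : ℂ) • K).toBlock p p) :=
      gibbsState_nonneg_of_posSemidef β hB (hpsd.submatrix Subtype.val)
    have hsplit : (((c : ℝ) : ℂ) • (1 : Matrix ι ι ℂ) + ((s : ℝ) : ℂ) • K).toBlock p p =
        (((c : ℝ) : ℂ)) • (1 : Matrix {a // p a} {a // p a} ℂ) + ((s : ℝ) : ℂ) • K.toBlock p p := by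
      ext a b
      simp only [toBlock_apply, Matrix.add_apply, Matrix.smul_apply, smul_eq_mul, Matrix.one_apply, Subtype.ext_iff]
    rw [hsplit, map_add, map_smul, map_smul, hone, smul_eq_mul, mul_one, smul_eq_mul] at h1
    obtain ⟨hre, -⟩ := Complex.nonneg_iff.mp h1
    rw [Complex.add_re, Complex.ofReal_re, Complex.re_ofReal_mul] at hre
    exact hre
  have hp1 := key 1 (by norm_num)
  have hm1 := key (-1) (by norm_num)
  rw [abs_le]
  constructor <;> linarith

end Sandwich

/-! ## §1 The `t–t′` Hubbard torus in a lattice `U(1)` gauge field and its handle twist -/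

section TorusTT

variable {L : ℕ} [NeZero L]

section Defs

variable (L)

/-- The **`t–t′` Hubbard torus in a lattice `U(1)` gauge field** (`t = 1`): nearest-neighbour Peierls phases `A`, diagonal-bond phases
`D_s(x)` on `x → x + j_s`, next-nearest-neighbour hopping `t′`, on-site `U`:
`H = H_A(1,U) − t′ Σ_{s,x,σ} [D_s(x) c†_{x+j_s,σ} c_{x,σ} + h.c.]`. [cite: Lieb1994, eq. (1)] -/
def magneticHubbardTorusTT' (A : GaugeConfig 2 L Circle) (D : Fin 2 → Site 2 L → Circle) (tp U : ℝ) :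
    Matrix (Finset (Orb (FermionTorus 2 L))) (Finset (Orb (FermionTorus 2 L))) ℂ :=
  magneticHubbardTorus L A 1 U + (-(tp : ℂ)) • diagPeierlsHopping L (fun s x => ((D s x : Circle) : ℂ))

/-- **The diagonal phases with an extra handle flux `θ`**: `D_s(x) ↦ D_s(x)·e^{iθ/L}` (both diagonal jumps advance `x₁` by one, so every
diagonal bond picks up the same twist factor as an `e₁`-bond). [cite: Watanabe2019, §2.2.3 and §4.1] -/
def diagTwist (D : Fin 2 → Site 2 L → Circle) (θ : ℝ) : Fin 2 → Site 2 L → Circle :=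
  fun s x => D s x * Circle.exp (θ / L)

/-- The **field-dressed `x₁`-kinetic operator of the `t–t′` torus**: `K^{A,D}_{t′} = K^A + t′·Σ_{s,x,σ}[D_s(x) c†_{x+j_s,σ}c_{x,σ} + h.c.]`
(Hazra–Verma–Randeria's `D̃` operator of the `t–t′` band, in the field). [cite: HazraVermaRanderia2019, eq. (4)] -/
def magneticKinOpTT' (A : GaugeConfig 2 L Circle) (D : Fin 2 → Site 2 L → Circle) (tp : ℝ) :
    Matrix (Finset (Orb (FermionTorus 2 L))) (Finset (Orb (FermionTorus 2 L))) ℂ :=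
  magneticKinOp L A + (tp : ℂ) • diagPeierlsHopping L (fun s x => ((D s x : Circle) : ℂ))

/-- **`log Z_p(θ)` of the handle-twisted `t–t′` magnetic torus on a coordinate sector** (`A ↦ A·τ_θ` on the `e₁`-bonds,
`D ↦ diagTwist L D θ` on the diagonal bonds). [cite: ScalapinoWhiteZhang1993, §II] -/
def magneticTwistLogZTT' (A : GaugeConfig 2 L Circle) (D : Fin 2 → Site 2 L → Circle) (tp U β θ : ℝ)
    (p : Finset (Orb (FermionTorus 2 L)) → Prop) [Fintype {a // p a}] [DecidableEq {a // p a}] : ℝ :=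
  Real.log (partitionFn β
    ((magneticHubbardTorusTT' L (A * uniformTwistConfig L θ) (diagTwist L D θ) tp U).toBlock p p)).re

end Defs

omit [NeZero L] in
/-- Zero extra flux leaves the diagonal phases unchanged. [cite: Watanabe2019, §2.2.3 and §4.1] -/
theorem diagTwist_zero (D : Fin 2 → Site 2 L → Circle) : diagTwist L D 0 = D := by
  funext s x
  rw [diagTwist, zero_div, Circle.exp_zero, mul_one]

/-- The `t–t′` magnetic torus is Hermitian. [cite: Lieb1994, eq. (1)] -/
theorem isHermitian_magneticHubbardTorusTT' (A : GaugeConfig 2 L Circle) (D : Fin 2 → Site 2 L → Circle) (tp U : ℝ) :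
    (magneticHubbardTorusTT' L A D tp U).IsHermitian := by
  refine (magneticHubbardTorus_isHermitian A 1 U).add ?_
  rw [← Complex.ofReal_neg]
  exact isHermitian_ofReal_smul (isHermitian_diagPeierlsHopping L _) _

/-- The field-dressed `x₁`-kinetic operator of the `t–t′` torus is Hermitian. [cite: HazraVermaRanderia2019, eq. (4)] -/
theorem isHermitian_magneticKinOpTT' (A : GaugeConfig 2 L Circle) (D : Fin 2 → Site 2 L → Circle) (tp : ℝ) :
    (magneticKinOpTT' L A D tp).IsHermitian :=
  (isHermitian_magneticKinOp A).add (isHermitian_ofReal_smul (isHermitian_diagPeierlsHopping L _) _)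

/-- A diagonal Peierls sum with unit-modulus amplitudes in a vector: `Re⟨φ, D_D φ⟩ = 2 Σ_{s,x,σ} Re(D_s(x)·h_{s,x,σ}(φ))`,
`h = ⟨φ, c†_{x+j_s,σ} c_{x,σ} φ⟩`. [cite: Watanabe2019, §2.2.1] -/
theorem re_star_dotProduct_diagPeierlsHopping_coe_mulVec (D : Fin 2 → Site 2 L → Circle)
    (φ : Fock (Orb (FermionTorus 2 L))) :
    (star φ ⬝ᵥ (diagPeierlsHopping L (fun s x => ((D s x : Circle) : ℂ)) *ᵥ φ)).re =
      2 * ∑ s : Fin 2, ∑ x : Site 2 L, ∑ σ : Fin 2,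
        (((D s x : Circle) : ℂ) *
          (star φ ⬝ᵥ ((creation (orb (FermionTorus.ofTorusSite (x + torusDiagJump L s)) σ) *
            annihilation (orb (FermionTorus.ofTorusSite x) σ)) *ᵥ φ))).re := by
  rw [re_star_dotProduct_diagPeierlsHopping_mulVec]
  simp only [Finset.mul_sum, Complex.mul_re]
  refine Finset.sum_congr rfl fun s _ => Finset.sum_congr rfl fun x _ => Finset.sum_congr rfl fun σ _ => ?_
  ring

/-- Scalar bookkeeping: `Re(a e^{iu} h) + Re(a e^{−iu} h) = 2 cos u · Re(a h)`. [folklore] -/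
private theorem re_mul_exp_mul_add_re_mul_exp_neg_mul (a h : ℂ) (u : ℝ) :
    (a * Complex.exp (((u : ℝ) : ℂ) * Complex.I) * h).re +
        (a * Complex.exp (((-u : ℝ) : ℂ) * Complex.I) * h).re =
      2 * Real.cos u * (a * h).re := by
  simp only [Complex.mul_re, Complex.mul_im, Complex.exp_ofReal_mul_I_re, Complex.exp_ofReal_mul_I_im,
    Real.cos_neg, Real.sin_neg]
  ring

/-- **The diagonal midpoint identity in a vector**: `Re⟨φ, D_{D·e^{iθ/L}} φ⟩ + Re⟨φ, D_{D·e^{−iθ/L}} φ⟩ = 2cos(θ/L)·Re⟨φ, D_D φ⟩` (the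
diagonal bond currents cancel between `±θ`). [cite: Watanabe2019, §2.2.3 and §4.1] -/
theorem re_star_dotProduct_diagTwist_add_neg_mulVec (D : Fin 2 → Site 2 L → Circle) (θ : ℝ)
    (φ : Fock (Orb (FermionTorus 2 L))) :
    (star φ ⬝ᵥ (diagPeierlsHopping L (fun s x => ((diagTwist L D θ s x : Circle) : ℂ)) *ᵥ φ)).re +
        (star φ ⬝ᵥ (diagPeierlsHopping L (fun s x => ((diagTwist L D (-θ) s x : Circle) : ℂ)) *ᵥ φ)).re =
      2 * Real.cos (θ / L) *
        (star φ ⬝ᵥ (diagPeierlsHopping L (fun s x => ((D s x : Circle) : ℂ)) *ᵥ φ)).re := by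
  rw [re_star_dotProduct_diagPeierlsHopping_coe_mulVec, re_star_dotProduct_diagPeierlsHopping_coe_mulVec,
    re_star_dotProduct_diagPeierlsHopping_coe_mulVec]
  have hτ : ∀ (s : Fin 2) (x : Site 2 L) (ψ : ℝ),
      ((diagTwist L D ψ s x : Circle) : ℂ) = ((D s x : Circle) : ℂ) * Complex.exp ((((ψ / L : ℝ)) : ℂ) * Complex.I) := by
    intro s x ψ
    rw [diagTwist, Circle.coe_mul, Circle.coe_exp]
  simp only [hτ, Finset.mul_sum]
  rw [← Finset.sum_add_distrib]
  refine Finset.sum_congr rfl fun s _ => ?_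
  rw [← Finset.sum_add_distrib]
  refine Finset.sum_congr rfl fun x _ => ?_
  rw [← Finset.sum_add_distrib]
  refine Finset.sum_congr rfl fun σ _ => ?_
  rw [neg_div, ← mul_add, re_mul_exp_mul_add_re_mul_exp_neg_mul]
  ring

/-- The `t–t′` magnetic torus in a vector: `Re⟨φ, H φ⟩ = Re⟨φ, H_A φ⟩ − t′ Re⟨φ, D_D φ⟩`. [cite: Lieb1994, eq. (1)] -/
theorem re_star_dotProduct_magneticHubbardTorusTT'_mulVec (A : GaugeConfig 2 L Circle) (D : Fin 2 → Site 2 L → Circle)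
    (tp U : ℝ) (φ : Fock (Orb (FermionTorus 2 L))) :
    (star φ ⬝ᵥ (magneticHubbardTorusTT' L A D tp U *ᵥ φ)).re =
      (star φ ⬝ᵥ (magneticHubbardTorus L A 1 U *ᵥ φ)).re -
        tp * (star φ ⬝ᵥ (diagPeierlsHopping L (fun s x => ((D s x : Circle) : ℂ)) *ᵥ φ)).re := by
  rw [magneticHubbardTorusTT', add_mulVec, dotProduct_add, Complex.add_re, smul_mulVec, dotProduct_smul, smul_eq_mul,
    ← Complex.ofReal_neg, Complex.re_ofReal_mul]
  ring

/-- The field-dressed `x₁`-kinetic operator in a vector: `Re⟨φ, K^{A,D}_{t′} φ⟩ = Re⟨φ, K^A φ⟩ + t′ Re⟨φ, D_D φ⟩`.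
[cite: HazraVermaRanderia2019, eq. (4)] -/
theorem re_star_dotProduct_magneticKinOpTT'_mulVec (A : GaugeConfig 2 L Circle) (D : Fin 2 → Site 2 L → Circle)
    (tp : ℝ) (φ : Fock (Orb (FermionTorus 2 L))) :
    (star φ ⬝ᵥ (magneticKinOpTT' L A D tp *ᵥ φ)).re =
      (star φ ⬝ᵥ (magneticKinOp L A *ᵥ φ)).re +
        tp * (star φ ⬝ᵥ (diagPeierlsHopping L (fun s x => ((D s x : Circle) : ℂ)) *ᵥ φ)).re := by
  rw [magneticKinOpTT', add_mulVec, dotProduct_add, Complex.add_re, smul_mulVec, dotProduct_smul, smul_eq_mul,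
    Complex.re_ofReal_mul]

/-- **The midpoint identity in a fixed vector, `t–t′` band in a field**:
`Re⟨φ, (H_θ + H_{−θ}) φ⟩ = 2 Re⟨φ, H φ⟩ + 2(1 − cos(θ/L)) Re⟨φ, K^{A,D}_{t′} φ⟩` (nearest-neighbour part:
`re_star_dotProduct_magneticTwist_add_neg_mulVec`; diagonal part: `re_star_dotProduct_diagTwist_add_neg_mulVec`).
[cite: Watanabe2019, §2.2.3 and §4.1] -/
theorem re_star_dotProduct_magneticTwistTT'_add_neg_mulVec (A : GaugeConfig 2 L Circle) (D : Fin 2 → Site 2 L → Circle)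
    (tp U θ : ℝ) (φ : Fock (Orb (FermionTorus 2 L))) :
    (star φ ⬝ᵥ ((magneticHubbardTorusTT' L (A * uniformTwistConfig L θ) (diagTwist L D θ) tp U +
        magneticHubbardTorusTT' L (A * uniformTwistConfig L (-θ)) (diagTwist L D (-θ)) tp U) *ᵥ φ)).re =
      2 * (star φ ⬝ᵥ (magneticHubbardTorusTT' L A D tp U *ᵥ φ)).re +
        2 * (1 - Real.cos (θ / L)) * (star φ ⬝ᵥ (magneticKinOpTT' L A D tp *ᵥ φ)).re := by
  have hNN := re_star_dotProduct_magneticTwist_add_neg_mulVec A U θ φ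
  rw [add_mulVec, dotProduct_add, Complex.add_re] at hNN
  have hdiag := re_star_dotProduct_diagTwist_add_neg_mulVec D θ φ
  rw [add_mulVec, dotProduct_add, Complex.add_re, re_star_dotProduct_magneticHubbardTorusTT'_mulVec,
    re_star_dotProduct_magneticHubbardTorusTT'_mulVec, re_star_dotProduct_magneticHubbardTorusTT'_mulVec,
    re_star_dotProduct_magneticKinOpTT'_mulVec]
  have h1 : (star φ ⬝ᵥ (diagPeierlsHopping L (fun s x => ((diagTwist L D θ s x : Circle) : ℂ)) *ᵥ φ)).re =
      2 * Real.cos (θ / L) * (star φ ⬝ᵥ (diagPeierlsHopping L (fun s x => ((D s x : Circle) : ℂ)) *ᵥ φ)).re -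
        (star φ ⬝ᵥ (diagPeierlsHopping L (fun s x => ((diagTwist L D (-θ) s x : Circle) : ℂ)) *ᵥ φ)).re := by
    linarith
  rw [h1]
  linear_combination hNN

/-- The **midpoint defect of the `t–t′` magnetic torus** and its negative are both positive semidefinite. [cite: Watanabe2019, §2.2.3 and §4.1] -/
theorem posSemidef_magneticMidpointDefectTT'_and_neg (A : GaugeConfig 2 L Circle) (D : Fin 2 → Site 2 L → Circle)
    (tp U θ : ℝ) :
    (magneticHubbardTorusTT' L (A * uniformTwistConfig L θ) (diagTwist L D θ) tp U +
          magneticHubbardTorusTT' L (A * uniformTwistConfig L (-θ)) (diagTwist L D (-θ)) tp U -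
        ((2 : ℝ) : ℂ) • magneticHubbardTorusTT' L A D tp U -
          ((2 * (1 - Real.cos (θ / L)) : ℝ) : ℂ) • magneticKinOpTT' L A D tp).PosSemidef ∧
      (-(magneticHubbardTorusTT' L (A * uniformTwistConfig L θ) (diagTwist L D θ) tp U +
          magneticHubbardTorusTT' L (A * uniformTwistConfig L (-θ)) (diagTwist L D (-θ)) tp U -
        ((2 : ℝ) : ℂ) • magneticHubbardTorusTT' L A D tp U -
          ((2 * (1 - Real.cos (θ / L)) : ℝ) : ℂ) • magneticKinOpTT' L A D tp)).PosSemidef := by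
  have hD : (magneticHubbardTorusTT' L (A * uniformTwistConfig L θ) (diagTwist L D θ) tp U +
        magneticHubbardTorusTT' L (A * uniformTwistConfig L (-θ)) (diagTwist L D (-θ)) tp U -
      ((2 : ℝ) : ℂ) • magneticHubbardTorusTT' L A D tp U -
        ((2 * (1 - Real.cos (θ / L)) : ℝ) : ℂ) • magneticKinOpTT' L A D tp).IsHermitian :=
    (((isHermitian_magneticHubbardTorusTT' _ _ tp U).add (isHermitian_magneticHubbardTorusTT' _ _ tp U)).sub
      (isHermitian_ofReal_smul (isHermitian_magneticHubbardTorusTT' A D tp U) _)).sub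
      (isHermitian_ofReal_smul (isHermitian_magneticKinOpTT' A D tp) _)
  have h0 : ∀ φ : Fock (Orb (FermionTorus 2 L)),
      star φ ⬝ᵥ ((magneticHubbardTorusTT' L (A * uniformTwistConfig L θ) (diagTwist L D θ) tp U +
          magneticHubbardTorusTT' L (A * uniformTwistConfig L (-θ)) (diagTwist L D (-θ)) tp U -
        ((2 : ℝ) : ℂ) • magneticHubbardTorusTT' L A D tp U -
          ((2 * (1 - Real.cos (θ / L)) : ℝ) : ℂ) • magneticKinOpTT' L A D tp) *ᵥ φ) = 0 := by
    intro φ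
    have hre : (star φ ⬝ᵥ ((magneticHubbardTorusTT' L (A * uniformTwistConfig L θ) (diagTwist L D θ) tp U +
          magneticHubbardTorusTT' L (A * uniformTwistConfig L (-θ)) (diagTwist L D (-θ)) tp U -
        ((2 : ℝ) : ℂ) • magneticHubbardTorusTT' L A D tp U -
          ((2 * (1 - Real.cos (θ / L)) : ℝ) : ℂ) • magneticKinOpTT' L A D tp) *ᵥ φ)).re = 0 := by
      rw [sub_mulVec, sub_mulVec, dotProduct_sub, dotProduct_sub, Complex.sub_re, Complex.sub_re,
        smul_mulVec, smul_mulVec, dotProduct_smul, dotProduct_smul, smul_eq_mul, smul_eq_mul,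
        Complex.re_ofReal_mul, Complex.re_ofReal_mul, re_star_dotProduct_magneticTwistTT'_add_neg_mulVec]
      ring
    have him : (star φ ⬝ᵥ ((magneticHubbardTorusTT' L (A * uniformTwistConfig L θ) (diagTwist L D θ) tp U +
          magneticHubbardTorusTT' L (A * uniformTwistConfig L (-θ)) (diagTwist L D (-θ)) tp U -
        ((2 : ℝ) : ℂ) • magneticHubbardTorusTT' L A D tp U -
          ((2 * (1 - Real.cos (θ / L)) : ℝ) : ℂ) • magneticKinOpTT' L A D tp) *ᵥ φ)).im = 0 := by
      have h := hD.im_star_dotProduct_mulVec_self φ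
      simpa using h
    exact Complex.ext (by simpa using hre) (by simpa using him)
  refine ⟨PosSemidef.of_dotProduct_mulVec_nonneg hD fun φ => by rw [h0 φ],
    PosSemidef.of_dotProduct_mulVec_nonneg hD.neg fun φ => ?_⟩
  rw [neg_mulVec, dotProduct_neg, h0 φ, neg_zero]

/-- **The midpoint identity in the Gibbs state of a sector, `t–t′` band in a field** (any Hermitian block Hamiltonian `B`).
[cite: Watanabe2019, §2.2.3 and §4.1] -/
theorem re_gibbsState_magneticTwistTT'_add_twist_neg (A : GaugeConfig 2 L Circle) (D : Fin 2 → Site 2 L → Circle)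
    (tp U θ β : ℝ) (p : Finset (Orb (FermionTorus 2 L)) → Prop) [Fintype {a // p a}] [DecidableEq {a // p a}]
    {B : Matrix {a // p a} {a // p a} ℂ} (hB : B.IsHermitian) :
    (gibbsState β B ((magneticHubbardTorusTT' L (A * uniformTwistConfig L θ) (diagTwist L D θ) tp U).toBlock p p -
          (magneticHubbardTorusTT' L A D tp U).toBlock p p)).re +
        (gibbsState β B ((magneticHubbardTorusTT' L (A * uniformTwistConfig L (-θ)) (diagTwist L D (-θ)) tp U).toBlock p p -
          (magneticHubbardTorusTT' L A D tp U).toBlock p p)).re =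
      2 * (1 - Real.cos (θ / L)) * (gibbsState β B ((magneticKinOpTT' L A D tp).toBlock p p)).re := by
  obtain ⟨hpos, hneg⟩ := posSemidef_magneticMidpointDefectTT'_and_neg A D tp U θ
  set M := magneticHubbardTorusTT' L (A * uniformTwistConfig L θ) (diagTwist L D θ) tp U +
      magneticHubbardTorusTT' L (A * uniformTwistConfig L (-θ)) (diagTwist L D (-θ)) tp U -
    ((2 : ℝ) : ℂ) • magneticHubbardTorusTT' L A D tp U -
      ((2 * (1 - Real.cos (θ / L)) : ℝ) : ℂ) • magneticKinOpTT' L A D tp with hMdef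
  have h1 : 0 ≤ gibbsState β B (M.toBlock p p) := gibbsState_nonneg_of_posSemidef β hB (hpos.submatrix Subtype.val)
  have h2 : 0 ≤ gibbsState β B ((-M).toBlock p p) := gibbsState_nonneg_of_posSemidef β hB (hneg.submatrix Subtype.val)
  have hnegblock : (-M).toBlock p p = -M.toBlock p p := rfl
  rw [hnegblock, map_neg, neg_nonneg] at h2
  have hzero : gibbsState β B (M.toBlock p p) = 0 := le_antisymm h2 h1
  have hsplit : (magneticHubbardTorusTT' L (A * uniformTwistConfig L θ) (diagTwist L D θ) tp U).toBlock p p -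
        (magneticHubbardTorusTT' L A D tp U).toBlock p p +
      ((magneticHubbardTorusTT' L (A * uniformTwistConfig L (-θ)) (diagTwist L D (-θ)) tp U).toBlock p p -
        (magneticHubbardTorusTT' L A D tp U).toBlock p p) =
      M.toBlock p p + ((2 * (1 - Real.cos (θ / L)) : ℝ) : ℂ) • (magneticKinOpTT' L A D tp).toBlock p p := by
    ext a b
    simp only [hMdef, toBlock_apply, Matrix.add_apply, Matrix.sub_apply, Matrix.smul_apply, smul_eq_mul]
    push_cast
    ring
  rw [← Complex.add_re, ← map_add, hsplit, map_add, hzero, zero_add, map_smul, smul_eq_mul, Complex.re_ofReal_mul]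

/-- **Thermal f-sum bound on the flux cost of the sector free energy, `t–t′` band in an arbitrary field** (every `L ≥ 1`, `A`, `D`,
`t′`, `U`, `β`, coordinate sector `p`; `⟨·⟩` the Gibbs state of the untwisted block):
`2 log Z_p(0) − 2β(1 − cos(θ/L)) Re⟨K^{A,D}_{t′}|_p⟩ ≤ log Z_p(θ) + log Z_p(−θ)` (Peierls–Bogoliubov at `±θ` and the midpoint identity).
[cite: ParamekantiTrivediRanderia1998, eq. (3) and §IV] -/
theorem log_partitionFn_toBlock_magneticTwistTT'_add_neg_ge (A : GaugeConfig 2 L Circle) (D : Fin 2 → Site 2 L → Circle)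
    (tp U θ β : ℝ) (p : Finset (Orb (FermionTorus 2 L)) → Prop) [Fintype {a // p a}] [DecidableEq {a // p a}] :
    2 * Real.log (partitionFn β ((magneticHubbardTorusTT' L A D tp U).toBlock p p)).re -
        2 * β * (1 - Real.cos (θ / L)) *
          (gibbsState β ((magneticHubbardTorusTT' L A D tp U).toBlock p p) ((magneticKinOpTT' L A D tp).toBlock p p)).re ≤
      Real.log (partitionFn β
          ((magneticHubbardTorusTT' L (A * uniformTwistConfig L θ) (diagTwist L D θ) tp U).toBlock p p)).re +
        Real.log (partitionFn β
          ((magneticHubbardTorusTT' L (A * uniformTwistConfig L (-θ)) (diagTwist L D (-θ)) tp U).toBlock p p)).re := by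
  rcases isEmpty_or_nonempty {a // p a} with hp | hp
  · simp [partitionFn, Matrix.trace, gibbsState_apply]
  set B := (magneticHubbardTorusTT' L A D tp U).toBlock p p with hBdef
  have hB : B.IsHermitian := (isHermitian_magneticHubbardTorusTT' A D tp U).submatrix _
  have hWp : ((magneticHubbardTorusTT' L (A * uniformTwistConfig L θ) (diagTwist L D θ) tp U).toBlock p p - B).IsHermitian :=
    ((isHermitian_magneticHubbardTorusTT' _ _ tp U).submatrix _).sub hB
  have hWm : ((magneticHubbardTorusTT' L (A * uniformTwistConfig L (-θ)) (diagTwist L D (-θ)) tp U).toBlock p p -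
      B).IsHermitian :=
    ((isHermitian_magneticHubbardTorusTT' _ _ tp U).submatrix _).sub hB
  have hPB1 := log_partitionFn_sub_le_log_partitionFn_add hB hWp β
  have hPB2 := log_partitionFn_sub_le_log_partitionFn_add hB hWm β
  rw [add_sub_cancel] at hPB1 hPB2
  have hsum := re_gibbsState_magneticTwistTT'_add_twist_neg A D tp U θ β p hB
  rw [← hBdef] at hsum
  have hkey : β * (gibbsState β B ((magneticHubbardTorusTT' L (A * uniformTwistConfig L θ) (diagTwist L D θ) tp U).toBlock p p -
        B)).re +
      β * (gibbsState β B ((magneticHubbardTorusTT' L (A * uniformTwistConfig L (-θ)) (diagTwist L D (-θ)) tp U).toBlock p p -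
        B)).re =
        β * (2 * (1 - Real.cos (θ / L)) * (gibbsState β B ((magneticKinOpTT' L A D tp).toBlock p p)).re) := by
    rw [← mul_add, hsum]
  linarith

/-! ### The crude field-robust bound `|Re⟨K^{A,D}_{t′}⟩| ≤ 2L²(1 + 2|t′|)` and the stiffness ceiling `1 + 2|t′|` -/

/-- For `L ≥ 2` the two ends of a diagonal bond are distinct orbitals (the jump moves `x₁` by one). [folklore] -/
private theorem orb_add_torusDiagJump_ne (hL : 2 ≤ L) (s : Fin 2) (x : Site 2 L) (σ : Fin 2) :
    orb (FermionTorus.ofTorusSite (x + torusDiagJump L s)) σ ≠ orb (FermionTorus.ofTorusSite x) σ := by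
  intro h
  have h' : FermionTorus.ofTorusSite (x + torusDiagJump L s) = FermionTorus.ofTorusSite x :=
    congrArg (fun o : Orb (FermionTorus 2 L) => (ofLex o).1) h
  have h'' := congrArg FermionTorus.toTorusSite h'
  rw [FermionTorus.toTorusSite_ofTorusSite, FermionTorus.toTorusSite_ofTorusSite] at h''
  have hj : torusDiagJump L s 0 = 1 := by simp [torusDiagJump]
  have h0 : x 0 + 1 = x 0 := by
    have := congrFun h'' 0
    rw [Pi.add_apply, hj] at this
    exact this
  have h1 : (1 : ZMod L) = 0 := by simpa using h0
  haveI : Fact (1 < L) := ⟨hL⟩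
  exact one_ne_zero h1

/-- For `L ≥ 2` a diagonal Peierls sum with unit-modulus amplitudes has `|Re⟨φ, D_D φ⟩| ≤ 4L²` in a unit vector (`4L²` bond terms, each
`≤ ½`: the one-body hopping between two modes has spectrum `{−1, 0, 1}`). [cite: Watanabe2019, §4.1] -/
theorem abs_re_star_dotProduct_diagPeierlsHopping_coe_mulVec_le (hL : 2 ≤ L) (D : Fin 2 → Site 2 L → Circle)
    {φ : Fock (Orb (FermionTorus 2 L))} (hφ : star φ ⬝ᵥ φ = 1) :
    |(star φ ⬝ᵥ (diagPeierlsHopping L (fun s x => ((D s x : Circle) : ℂ)) *ᵥ φ)).re| ≤ 4 * (L : ℝ) ^ 2 := by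
  rw [re_star_dotProduct_diagPeierlsHopping_coe_mulVec, abs_mul, abs_two]
  have hterm : ∀ (s : Fin 2) (x : Site 2 L) (σ : Fin 2),
      |(((D s x : Circle) : ℂ) *
          (star φ ⬝ᵥ ((creation (orb (FermionTorus.ofTorusSite (x + torusDiagJump L s)) σ) *
            annihilation (orb (FermionTorus.ofTorusSite x) σ)) *ᵥ φ))).re| ≤ 1 / 2 := by
    intro s x σ
    refine (Complex.abs_re_le_norm _).trans ?_
    rw [norm_mul, Circle.norm_coe, one_mul]
    exact norm_star_dotProduct_creation_mul_annihilation_mulVec_le_half hφ (orb_add_torusDiagJump_ne hL s x σ)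
  have hsum : |∑ s : Fin 2, ∑ x : Site 2 L, ∑ σ : Fin 2,
      (((D s x : Circle) : ℂ) *
          (star φ ⬝ᵥ ((creation (orb (FermionTorus.ofTorusSite (x + torusDiagJump L s)) σ) *
            annihilation (orb (FermionTorus.ofTorusSite x) σ)) *ᵥ φ))).re| ≤ 2 * (L : ℝ) ^ 2 := by
    refine (Finset.abs_sum_le_sum_abs _ _).trans ?_
    have hx : ∀ s ∈ (Finset.univ : Finset (Fin 2)), |∑ x : Site 2 L, ∑ σ : Fin 2,
        (((D s x : Circle) : ℂ) *
          (star φ ⬝ᵥ ((creation (orb (FermionTorus.ofTorusSite (x + torusDiagJump L s)) σ) *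
            annihilation (orb (FermionTorus.ofTorusSite x) σ)) *ᵥ φ))).re| ≤ (L : ℝ) ^ 2 := by
      intro s _
      refine (Finset.abs_sum_le_sum_abs _ _).trans ?_
      have hy : ∀ x ∈ (Finset.univ : Finset (Site 2 L)), |∑ σ : Fin 2,
          (((D s x : Circle) : ℂ) *
            (star φ ⬝ᵥ ((creation (orb (FermionTorus.ofTorusSite (x + torusDiagJump L s)) σ) *
              annihilation (orb (FermionTorus.ofTorusSite x) σ)) *ᵥ φ))).re| ≤ 1 := by
        intro x _
        refine (Finset.abs_sum_le_sum_abs _ _).trans ?_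
        refine (Finset.sum_le_sum fun σ _ => hterm s x σ).trans ?_
        norm_num
      refine (Finset.sum_le_sum hy).trans ?_
      rw [Finset.sum_const, Finset.card_univ, nsmul_eq_mul, mul_one]
      have hcard : (Fintype.card (Site 2 L) : ℝ) = (L : ℝ) ^ 2 := by
        rw [Fintype.card_fun, ZMod.card, Fintype.card_fin]; push_cast; ring
      rw [hcard]
    refine (Finset.sum_le_sum hx).trans ?_
    rw [Finset.sum_const, Finset.card_univ, Fintype.card_fin, nsmul_eq_mul]
    push_cast
    exact le_rfl
  calc (2 : ℝ) * |∑ s : Fin 2, ∑ x : Site 2 L, ∑ σ : Fin 2,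
        (((D s x : Circle) : ℂ) *
          (star φ ⬝ᵥ ((creation (orb (FermionTorus.ofTorusSite (x + torusDiagJump L s)) σ) *
            annihilation (orb (FermionTorus.ofTorusSite x) σ)) *ᵥ φ))).re|
      ≤ 2 * (2 * (L : ℝ) ^ 2) := by gcongr
    _ = 4 * (L : ℝ) ^ 2 := by ring

/-- For `L ≥ 2` the field-dressed `x₁`-kinetic quadratic form of the `t–t′` torus is at most `2L²(1 + 2|t′|)` in modulus in a unit
vector. [cite: Watanabe2019, §4.1] -/
theorem abs_re_star_dotProduct_magneticKinOpTT'_mulVec_le (hL : 2 ≤ L) (A : GaugeConfig 2 L Circle)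
    (D : Fin 2 → Site 2 L → Circle) (tp : ℝ) {φ : Fock (Orb (FermionTorus 2 L))} (hφ : star φ ⬝ᵥ φ = 1) :
    |(star φ ⬝ᵥ (magneticKinOpTT' L A D tp *ᵥ φ)).re| ≤ 2 * (L : ℝ) ^ 2 * (1 + 2 * |tp|) := by
  rw [re_star_dotProduct_magneticKinOpTT'_mulVec]
  have h1 := abs_re_star_dotProduct_magneticKinOp_mulVec_le hL A hφ
  have h2 := abs_re_star_dotProduct_diagPeierlsHopping_coe_mulVec_le hL D hφ
  refine (abs_add_le _ _).trans ?_
  rw [abs_mul]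
  have h3 : |tp| * |(star φ ⬝ᵥ (diagPeierlsHopping L (fun s x => ((D s x : Circle) : ℂ)) *ᵥ φ)).re| ≤
      |tp| * (4 * (L : ℝ) ^ 2) := mul_le_mul_of_nonneg_left h2 (abs_nonneg _)
  nlinarith

/-- **`|Re⟨K^{A,D}_{t′}|_p⟩_{β,B}| ≤ 2L²(1 + 2|t′|)`** for `L ≥ 2`, every gauge field, every coordinate sector and the Gibbs state of ANY
Hermitian block Hamiltonian `B` (Loewner sandwich by normalising vectors, compressed to the sector). [cite: Watanabe2019, §4.1] -/
theorem abs_re_gibbsState_magneticKinOpTT'_le (hL : 2 ≤ L) (A : GaugeConfig 2 L Circle) (D : Fin 2 → Site 2 L → Circle)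
    (tp β : ℝ) (p : Finset (Orb (FermionTorus 2 L)) → Prop) [Fintype {a // p a}] [DecidableEq {a // p a}]
    {B : Matrix {a // p a} {a // p a} ℂ} (hB : B.IsHermitian) :
    |(gibbsState β B ((magneticKinOpTT' L A D tp).toBlock p p)).re| ≤ 2 * (L : ℝ) ^ 2 * (1 + 2 * |tp|) :=
  abs_re_gibbsState_toBlock_le_of_unit_bound (isHermitian_magneticKinOpTT' A D tp) (by positivity)
    (fun _ hφ => abs_re_star_dotProduct_magneticKinOpTT'_mulVec_le hL A D tp hφ) β p hB

/-- `log Z_p` at zero extra flux is the sector log-partition function of the untwisted `t–t′` magnetic torus.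
[cite: Watanabe2019, §2.2.1] -/
theorem magneticTwistLogZTT'_zero (A : GaugeConfig 2 L Circle) (D : Fin 2 → Site 2 L → Circle) (tp U β : ℝ)
    (p : Finset (Orb (FermionTorus 2 L)) → Prop) [Fintype {a // p a}] [DecidableEq {a // p a}] :
    magneticTwistLogZTT' L A D tp U β 0 p =
      Real.log (partitionFn β ((magneticHubbardTorusTT' L A D tp U).toBlock p p)).re := by
  rw [magneticTwistLogZTT', uniformTwistConfig_zero, mul_one, diagTwist_zero]

/-- **The symmetrised thermal twist of the `t–t′` magnetic torus costs at most `2β(1 + 2|t′|)θ²`** (`L ≥ 2`, `β ≥ 0`; every `A`, `D`,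
`U`, coordinate sector `p`): `2 log Z_p(0) − 2β(1 + 2|t′|)θ² ≤ log Z_p(θ) + log Z_p(−θ)`.
[cite: ParamekantiTrivediRanderia1998, eq. (3) and §IV] -/
theorem magneticTwistLogZTT'_add_neg_ge (hL : 2 ≤ L) (A : GaugeConfig 2 L Circle) (D : Fin 2 → Site 2 L → Circle)
    (tp U θ : ℝ) {β : ℝ} (hβ : 0 ≤ β) (p : Finset (Orb (FermionTorus 2 L)) → Prop) [Fintype {a // p a}]
    [DecidableEq {a // p a}] :
    2 * magneticTwistLogZTT' L A D tp U β 0 p - 2 * β * (1 + 2 * |tp|) * θ ^ 2 ≤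
      magneticTwistLogZTT' L A D tp U β θ p + magneticTwistLogZTT' L A D tp U β (-θ) p := by
  rw [magneticTwistLogZTT'_zero]
  unfold magneticTwistLogZTT'
  have h := log_partitionFn_toBlock_magneticTwistTT'_add_neg_ge A D tp U θ β p
  have hK := abs_re_gibbsState_magneticKinOpTT'_le hL A D tp β p
    ((isHermitian_magneticHubbardTorusTT' A D tp U).submatrix (Subtype.val : {a // p a} → _))
  set g := (gibbsState β ((magneticHubbardTorusTT' L A D tp U).toBlock p p)
    ((magneticKinOpTT' L A D tp).toBlock p p)).re with hg
  have hL0 : (0 : ℝ) < L := Nat.cast_pos.2 (NeZero.pos L)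
  have hc : 0 ≤ 1 - Real.cos (θ / L) := sub_nonneg.2 (Real.cos_le_one _)
  have hcos : 2 * (1 - Real.cos (θ / L)) ≤ (θ / L) ^ 2 := by
    have h := Real.one_sub_sq_div_two_le_cos (x := θ / L)
    nlinarith
  have hgle : g ≤ 2 * (L : ℝ) ^ 2 * (1 + 2 * |tp|) := (le_abs_self g).trans hK
  have htp : 0 ≤ 1 + 2 * |tp| := by positivity
  have hstep1 : 2 * β * (1 - Real.cos (θ / L)) * g ≤
      2 * β * (1 - Real.cos (θ / L)) * (2 * (L : ℝ) ^ 2 * (1 + 2 * |tp|)) := by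
    have : 0 ≤ 2 * β * (1 - Real.cos (θ / L)) := by positivity
    exact mul_le_mul_of_nonneg_left hgle this
  have hstep2 : 2 * β * (1 - Real.cos (θ / L)) * (2 * (L : ℝ) ^ 2 * (1 + 2 * |tp|)) ≤
      2 * β * (1 + 2 * |tp|) * θ ^ 2 := by
    calc 2 * β * (1 - Real.cos (θ / L)) * (2 * (L : ℝ) ^ 2 * (1 + 2 * |tp|))
        = 2 * β * (1 + 2 * |tp|) * ((2 * (1 - Real.cos (θ / L))) * (L : ℝ) ^ 2) := by ring
      _ ≤ 2 * β * (1 + 2 * |tp|) * ((θ / L) ^ 2 * (L : ℝ) ^ 2) := by gcongr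
      _ = 2 * β * (1 + 2 * |tp|) * θ ^ 2 := by field_simp
  linarith

/-- **Every THERMAL flux stiffness of the `t–t′` Hubbard torus in an orbital field is at most `1 + 2|t′|`** (units of `t`; `L ≥ 2`,
`β > 0`): if `ρ` and `θ₀ > 0` satisfy `β ρ θ² ≤ log Z_p(0) − log Z_p(θ)` for all `|θ| ≤ θ₀`, then `ρ ≤ 1 + 2|t′|` — for EVERY lattice `U(1)`
gauge field (`A` on the nearest-neighbour bonds, `D` on the diagonal bonds), every `U`, every coordinate sector (hence every filling and
every uniform Zeeman field) and every temperature. At `t′ = 0` this is `magneticThermalFluxStiffness_le_one`. With the cell's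
Nelson–Kosterlitz dictionary (a hypothesis there): `k_BT_KT ≤ (π/4)(1 + 2|t′|)·t` per plane at every orbital field, no `T = 0 → T_KT⁻`
transfer. [cite: ScalapinoWhiteZhang1993, §II] [cite: ParamekantiTrivediRanderia1998, eq. (3) and §IV] -/
theorem magneticThermalFluxStiffnessTT'_le (hL : 2 ≤ L) (A : GaugeConfig 2 L Circle) (D : Fin 2 → Site 2 L → Circle)
    (tp U : ℝ) (p : Finset (Orb (FermionTorus 2 L)) → Prop) [Fintype {a // p a}] [DecidableEq {a // p a}]
    {β ρ θ₀ : ℝ} (hβ : 0 < β) (hθ₀ : 0 < θ₀)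
    (hst : ∀ θ : ℝ, |θ| ≤ θ₀ →
      β * ρ * θ ^ 2 ≤ magneticTwistLogZTT' L A D tp U β 0 p - magneticTwistLogZTT' L A D tp U β θ p) :
    ρ ≤ 1 + 2 * |tp| := by
  have hp := hst θ₀ (by rw [abs_of_pos hθ₀])
  have hm := hst (-θ₀) (by rw [abs_neg, abs_of_pos hθ₀])
  have hb := magneticTwistLogZTT'_add_neg_ge hL A D tp U θ₀ hβ.le p
  have hsq : 0 < β * θ₀ ^ 2 := by positivity
  rw [neg_sq] at hm
  nlinarith

end TorusTT

end Literature.MathematicalPhysics.QuantumLattice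

end
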